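import Literature.Claims.NS.Durmagambetov2015
import Mathlib.MeasureTheory.Group.Integral
import Mathlib.MeasureTheory.Measure.Haar.Unique
import Mathlib.Analysis.Calculus.BumpFunction.Normed
import Mathlib.Analysis.Complex.Trigonometric
import HarnessLib

/-!
# C30 `Durmagambetov2015` — refutation of Step 8 (Lemma 17 (33), pp.92–93)

Cell `ns-claims` (D-0090 NS-CLAIMS SWEEP), claim C30, refuter `ns-claims-refuter-2` (g0). The claim file
`Literature.Claims.NS.Durmagambetov2015` (typist-3 g2, p477686) types the pointwise reconstruction of a
scattering potential, LEMMA 17 with (33): `|q|_{x=0} ≤ Σ_{i≥1}(C₀|TQq̃|_{|k|=0})^i`, for admissible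
potentials with the smallness `‖q‖_{L₂} + max_k|q̃| < α < 1`, as `Step8_reconstruction33` — the only
printed route from the smallness of p.97 to the pointwise bound of Theorem 6.

It is false at its own (NS-free) grain. Witness: `q = a·ψ`, `ψ` a smooth bump centred at the origin
(even: `ψ(−x) = ψ(x)`), `a > 0` small. The Fourier transform of an even real function is even, so the
integrand of the symmetric principal value `TQq̃|_{|k|=0} = (2πi)⁻¹∫₀^∞ (q̃(sd) − q̃(−sd))/s ds`
vanishes identically: the bound `B = 0` is admissible, the series is `0`, and (33) forces `q(0) = 0`,
while `q(0) = a > 0`. The smallness hypothesis is met by taking `a` small (`‖q‖₂ + a∫ψ < 1/2`).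

WHAT THIS IS NOT: not a claim about NS regularity or blow-up; not a claim about any author beyond the
typed locator.
-/

set_option linter.dupNamespace false

noncomputable section

open MeasureTheory Metric

namespace Summit.NavierStokesRegularity.NavierStokesRegularity.Theorems.Durmagambetov2015

open Literature.Claims.NS.Durmagambetov2015

/-- The even bump `ψ`: a smooth bump function centred at the origin of `ℝ³`, `= 1` on the closed unit
ball, supported in the ball of radius `2`, values in `[0,1]`. -/
def psi : ContDiffBump (0 : EuclideanSpace ℝ (Fin 3)) := ⟨1, 2, one_pos, one_lt_two⟩

/-- The paper's Fourier transform of an even potential is even: `q̃(−k) = q̃(k)`. -/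
theorem ft_neg_of_even {q : EuclideanSpace ℝ (Fin 3) → ℝ} (hq : ∀ x, q (-x) = q x)
    (k : EuclideanSpace ℝ (Fin 3)) : ft q (-k) = ft q k := by
  unfold ft
  rw [← integral_neg_eq_self
    (fun x => (q x : ℂ) * Complex.exp (Complex.I * ((inner ℝ (-k) x : ℝ) : ℂ))) volume]
  simp only [hq, inner_neg_neg]

/-- For an even potential the `|k| = 0` trace of `TQq̃` vanishes in every direction pair: the
integrand `(q̃(sd) − q̃(−sd))/s` of the symmetric principal value is identically zero. -/
theorem tq0_eq_zero_of_even {q : EuclideanSpace ℝ (Fin 3) → ℝ} (hq : ∀ x, q (-x) = q x)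
    (d : EuclideanSpace ℝ (Fin 3)) : tq0 q d = 0 := by
  simp [tq0, ft_neg_of_even hq]

/-- `|q̃(k)| ≤ ∫|q|` (the kernel `e^{i(k,x)}` has modulus one). -/
theorem norm_ft_le (q : EuclideanSpace ℝ (Fin 3) → ℝ) (k : EuclideanSpace ℝ (Fin 3)) :
    ‖ft q k‖ ≤ ∫ x, |q x| := by
  unfold ft
  refine (norm_integral_le_integral_norm _).trans (le_of_eq ?_)
  congr 1
  ext x
  rw [norm_mul, Complex.norm_real, Complex.norm_exp_I_mul_ofReal, mul_one, Real.norm_eq_abs]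

/-- **Refutation of Step 8 — LEMMA 17 (33), pp.92–93** (`refuted-substantive` at the typed grain):
for every candidate series constant `C₀ ≥ 0` the even potential `q = a·ψ` (`a > 0` small) satisfies
every hypothesis of the typed lemma with the admissible bound `B = 0` for `|TQq̃|_{|k|=0}`, so (33)
would give `|q(0)| ≤ 0`, whereas `q(0) = a > 0`. No cheap repair: any version of (33) whose right-hand
side is a function of the `|k| = 0` trace of `TQq̃` alone vanishing at `0` is killed by the same even
potentials (the trace is blind to the even part of `q`, which carries `q(0)`). -/
theorem not_Step8_reconstruction33 :
    ¬ Literature.Claims.NS.Durmagambetov2015.Step8_reconstruction33 := by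
  rintro ⟨C₀, -, H⟩
  -- the two integrals of the bump entering the smallness bookkeeping
  obtain ⟨P, hPdef⟩ : ∃ P : ℝ, P = ∫ x, psi x := ⟨_, rfl⟩
  obtain ⟨Y, hYdef⟩ : ∃ Y : ℝ, Y = ∫ x, psi x ^ 2 := ⟨_, rfl⟩
  have hP : 0 ≤ P := hPdef ▸ integral_nonneg fun x => psi.nonneg
  have hY : 0 ≤ Y := hYdef ▸ integral_nonneg fun x => sq_nonneg _
  -- the amplitude
  obtain ⟨a, hadef⟩ : ∃ a : ℝ, a = 1 / (4 * (P + Y + 2)) := ⟨_, rfl⟩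
  have ha : 0 < a := by rw [hadef]; positivity
  -- the witness potential
  set q : EuclideanSpace ℝ (Fin 3) → ℝ := fun x => a * psi x with hqdef
  have hq_even : ∀ x, q (-x) = q x := fun x => by simp [hqdef, psi.neg]
  have hq_nonneg : ∀ x, 0 ≤ q x := fun x => mul_nonneg ha.le psi.nonneg
  have hqc : HasCompactSupport q := psi.hasCompactSupport.mul_left
  have hq_cont : Continuous q := continuous_const.mul psi.continuous
  have hpot : IsPotential q := by
    refine ⟨contDiff_const.mul psi.contDiff, hq_cont.integrable_of_hasCompactSupport hqc, ?_⟩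
    have h2 : (fun x => q x ^ 2) = q * q := by ext x; simp [pow_two]
    rw [h2]
    exact (hq_cont.mul hq_cont).integrable_of_hasCompactSupport hqc.mul_right
  -- the Fourier-side bound `S = a·P`
  have hS : ∀ k, ‖ft q k‖ ≤ a * P := fun k => by
    refine (norm_ft_le q k).trans (le_of_eq ?_)
    rw [hPdef, ← integral_const_mul]
    congr 1
    ext x
    rw [abs_of_nonneg (hq_nonneg x)]
  -- the `L₂` bound `‖q‖₂ ≤ a·(Y + 1)`
  have hl2 : l2 q ≤ a * (Y + 1) := by
    have hint : ∫ x, q x ^ 2 = a ^ 2 * Y := by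
      rw [hYdef, ← integral_const_mul]
      congr 1
      ext x
      simp [hqdef, mul_pow]
    have hle : a ^ 2 * Y ≤ (a * (Y + 1)) ^ 2 := by nlinarith [sq_nonneg a, sq_nonneg Y]
    calc l2 q = Real.sqrt (a ^ 2 * Y) := by rw [l2, hint]
      _ ≤ Real.sqrt ((a * (Y + 1)) ^ 2) := Real.sqrt_le_sqrt hle
      _ = a * (Y + 1) := Real.sqrt_sq (by positivity)
  -- smallness `‖q‖₂ + S < 1/2`
  have hsmall : l2 q + a * P < 1 / 2 := by
    have hsum : l2 q + a * P ≤ a * (P + Y + 1) := by linarith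
    have hlt : a * (P + Y + 1) < 1 / 2 := by
      rw [hadef, div_mul_eq_mul_div, one_mul, div_lt_div_iff₀ (by positivity) two_pos]
      nlinarith
    exact hsum.trans_lt hlt
  -- the admissible bound `B = 0` for the `|k| = 0` trace
  have hB : ∀ d : EuclideanSpace ℝ (Fin 3), ‖d‖ ≤ 2 → ‖tq0 q d‖ ≤ 0 := fun d _ => by
    rw [tq0_eq_zero_of_even hq_even, norm_zero]
  -- (33) at the witness
  have h33 := H (1 / 2) (by norm_num) q hpot (a * P) hS hsmall 0 le_rfl hB (by simp)
  have hq0 : q 0 = a := by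
    simp [hqdef, psi.one_of_mem_closedBall (mem_closedBall_self psi.rIn_pos.le)]
  rw [hq0, abs_of_pos ha] at h33
  simp at h33
  exact absurd h33 (not_le.mpr ha)

end Summit.NavierStokesRegularity.NavierStokesRegularity.Theorems.Durmagambetov2015

end

-- WHAT THIS IS NOT: not a claim about NS regularity or blow-up; not a claim about any author beyond the typed locator.
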